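import Literature.IUT.HodgeArakelov.RadialExamples
import HarnessLib

/-!
# [IUTchII] Example 1.8 (iii): the twisted iso-class groupoid `TwistedIsoClass P Γ` is INHABITED (non-vacuity)

Mochizuki, *Inter-universal Teichmüller theory II*, §1 Example 1.8 (iii), kurims manuscript (Dec. 2020) pp. 37–38
[claim: Mochizuki2012, status: disputed] (IUTchII §1 Ex 1.8 (iii), kurims pp.37-38): the coric data of the radial
environment of (iii) are "a topological group `G` isomorphic to `G_k`" acting on `O^×(G)`, with morphisms "a
`Γ`-multiple of the isomorphism … induced by an isomorphism of topological groups `G ≅ G*`" — typed by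
abc-iut-L6-t1 as the groupoid `Literature.IUT.HodgeArakelov.TwistedIsoClass P Γ` (objects: isomorphs of `P`;
morphisms: pairs `(e, γ)`), `RadialExamples.lean`.

PROOF-ONLY non-vacuity file of the abc-iut cell (L6 row call «NV-L6 WAVE», §F v1.18p; interface census
HOME/staging/w5/w5-d114/INHABITATION-CENSUS-L6-v3.md §A rows 95–96: zero producers of `TwistedIsoClass` and of
`TwistedIsoClass.Hom`). GENUINE model: for EVERY topological group `P` and twist group `Γ` the reference object
is `P` itself with the identity isomorphism — exactly the printed base point "`G_k` [itself]"; at the [IUTchII] §1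
setting `S : ThetaSetting` this is the coric datum `G_k = S.Gk` of `ex18iii S Γ`. Every twist `γ ∈ Γ` is realised
by a morphism, so the hom-types are inhabited non-degenerately (not only by identities). No `def`, no `instance`,
no `structure`: witnesses are built inside the theorem terms. Nothing here takes a side on [IUTchIII] Cor. 3.12.
-/

namespace Literature.IUT.HodgeArakelov

open CategoryTheory

universe u

namespace TwistedIsoClass

/-- **Non-vacuity of `TwistedIsoClass P Γ` (genuine model)**: the reference topological group `P` itself, with
the identity isomorphism `P ≃ₜ* P`, is an object — for every `P` and every twist group `Γ` ([IUTchII] Ex. 1.8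
(iii): the datum "`G` isomorphic to `G_k`" is inhabited by `G_k`).
[claim: Mochizuki2012, status: disputed] (IUTchII §1 Ex 1.8 (iii), kurims p.38) -/
theorem nonempty_model (P : TopGroup.{u}) (Γ : Type u) [Group Γ] : Nonempty (TwistedIsoClass P Γ) :=
  ⟨{ G := P, iso := ⟨ContinuousMulEquiv.refl P⟩ }⟩

/-- **Non-vacuity at the [IUTchII] §1 setting**: for `S : ThetaSetting` (abc-iut-L6-t1, `MonoThetaCyclotomes`)
the coric category `TwistedIsoClass S.Gk Γ` of `ex18iii S Γ` contains the coric datum `G_k` itself.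
[claim: Mochizuki2012, status: disputed] (IUTchII §1 Ex 1.8 (iii), kurims p.38) -/
theorem nonempty_model_Gk (S : ThetaSetting.{u}) (Γ : Type u) [Group Γ] : Nonempty (TwistedIsoClass S.Gk Γ) :=
  nonempty_model S.Gk Γ

/-- **Every twist is realised by a morphism**: for objects `X, Y` of `TwistedIsoClass P Γ` and every `γ ∈ Γ`
there is a morphism `X ⟶ Y` whose `Γ`-component is `γ` ("a `Γ`-multiple of the isomorphism induced by an
isomorphism of topological groups", p. 38) — so `TwistedIsoClass.Hom` is inhabited, and not only by identities.
[claim: Mochizuki2012, status: disputed] (IUTchII §1 Ex 1.8 (iii), kurims p.38) -/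
theorem exists_hom_twist {P : TopGroup.{u}} {Γ : Type u} [Group Γ] (X Y : TwistedIsoClass P Γ) (γ : Γ) :
    ∃ f : X ⟶ Y, f.twist = γ := by
  obtain ⟨e⟩ := X.iso
  obtain ⟨e'⟩ := Y.iso
  exact ⟨⟨e.trans e'.symm, γ⟩, rfl⟩

/-- The hom-type between any two objects is inhabited (in particular census row `TwistedIsoClass.Hom`).
[claim: Mochizuki2012, status: disputed] (IUTchII §1 Ex 1.8 (iii), kurims p.38) -/
theorem nonempty_hom_model {P : TopGroup.{u}} {Γ : Type u} [Group Γ] (X Y : TwistedIsoClass P Γ) :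
    Nonempty (TwistedIsoClass.Hom X Y) := by
  obtain ⟨f, -⟩ := exists_hom_twist X Y 1
  exact ⟨f⟩

/-- The twist component distinguishes morphisms: if `Γ` has an element `γ ≠ 1`, the model object carries a
NON-identity endomorphism (the groupoid is not codiscrete) — the `Γ`-indeterminacy of Ex. 1.8 (iii)/(iv) is
visible in the kernel. [claim: Mochizuki2012, status: disputed] (IUTchII §1 Ex 1.8 (iii), kurims p.38) -/
theorem exists_end_ne_id {P : TopGroup.{u}} {Γ : Type u} [Group Γ] {γ : Γ} (hγ : γ ≠ 1)
    (X : TwistedIsoClass P Γ) : ∃ f : X ⟶ X, f ≠ 𝟙 X := by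
  obtain ⟨f, hf⟩ := exists_hom_twist X X γ
  refine ⟨f, fun h => hγ ?_⟩
  rw [← hf, h]
  rfl

end TwistedIsoClass

/-- Consequence for the environment of Ex. 1.8 (iii): the coric category of `ex18iii S Γ` is nonempty, so the
radial algorithm (the projection) has inhabited source and target. [claim: Mochizuki2012, status: disputed]
(IUTchII §1 Ex 1.8 (iii), kurims p.38) -/
theorem ex18iii_coric_nonempty (S : ThetaSetting.{u}) (Γ : Type u) [Group Γ] :
    Nonempty (ex18iii S Γ).C ∧ Nonempty (ex18iii S Γ).R :=
  ⟨TwistedIsoClass.nonempty_model_Gk S Γ,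
    ⟨(IsoClass.base S.PiX, (TwistedIsoClass.nonempty_model_Gk S Γ).some)⟩⟩

end Literature.IUT.HodgeArakelov
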